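import Summits.QuantumFields.YangMills.Theorems.BalabanUVNodesN16AtReadingOfRecord13
import Summits.QuantumFields.YangMills.Theorems.BalabanUVNodesN16HolderMSSlotWindow
import Summits.QuantumFields.YangMills.Theorems.BalabanUVNodesN16SlotWindow

/-!
# Route «BalabanUVNodes», cluster K4 «SpineRates» — node N16 = NE3 AT THE STAGE-13 READING OF RECORD FROM ITS TWO IN-EDGES BY NAME, LETTERS CHOSEN: N05's leaf
# (`Thm4Body` ∕ `Prop3Body` on the univ sub-family of `zdGF3 (M_N ℂ) F.L β len`) and N07's LINEAR leaf (`LeafH3sup … ε (C·ε) (C·ε)` for every small class radius `ε`), once per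
# family, give SOME letters of record `ℓ₃` with `S_N16 (RRec₁₃On (readingOfRecord₁₃ w1 ℓ₃ ne2 ne1) Rg)` (β = 1, the stub of record) — resp. `S_N16HolderMS β (…)` (repair R-β″)
# — TOGETHER WITH dag-n21-d's numerals and THE END's proviso at the same letters; no letter line is left to the composer

Cell `pub-ymgap`, seat `pub-ymgap-dag-n16-e` (R134 acceleration seat (a), strategy s2 = BY-NAME KNIT at the record; HUMAN RULING D-0062; chair R424 venue), generation 6,
module 27 (THEOREMS ONLY, 0 `def`, 0 `sorry`).  `bears_on: R4∕N16 · edges N05 → N16, N07 → N16 · out-edge N16 → N21 · K3‴ SpineGivenEndpointR13 (stmt-QuantumFields-19912,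
`--supports … --as helper`)`.

WHY.  Every N16 LINE in the tree (module 20 §4∕§5, 23 §2∕§3, 26 §3; files 14∕17∕18 at ₁₂) takes the letters `ℓ₃ F`, the averaging letter `α F` and N07's leaf letters
`b' F, c' F` as PARAMETERS under ≈ 20 displayed letter lines, and proves separately that the lines are jointly satisfiable (`exists_window_letters_numerals(_H∕_HMS)`).  A composer
at the reading of record (dag-n27-c XXXVII §8 ∕ XL ∕ XLI, plan g66's `stub_rates13`) would still have to CHOOSE the letters and thread the lines.  Here the choice is MADE, once per
family, from the two in-edge interfaces stated in their producers' own currencies and asked UNGUARDED (both are about `F.L`-indexed objects — N05's GF-data family on `ℤ⁴` and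
RR-1's `2·L^m`-periodic `SU(N)` data — and do not read the Stage-13 tuple): N05 = its Thm-4 ∕ Prop-3 bodies with their constants and window (n05-a's leaf of record, unpacked as in
`…N16LeafSlotRS`), N07 = [Balaban1985Variational] Thm 1 (8)+(10) TYPE with LINEAR regularity letters `b = c = C·ε` below a class-radius threshold `ε₀` (dag-ref-B READ-445's linear
recipe, file 17).  The letters are those of `exists_window_letters_numerals` with the class radius shrunk below `ε₀` and `α∕(2048·(C+1))`, so N07's `C·ε` meets the slot's
`b' ≤ α∕2048`, `c' ≤ α∕24`.

CONTENT.
§1 `exists_window_letters_linearLeaf` — the letter witness, THRESHOLD-PARAMETRIC (`Λ₁ := r`, `C := Cof` for any `r > 0`, `Cof`): every line of the N16 LINES, N21's numerals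
  (`0 < b`, `512·5·8·L²·b ≤ 1`, `0 < Λ₂'`), `ε ≤ r`, `ε ≤ ε₀`, `C·ε ≤ α∕2048`.
§2 β = 1 (THE STUB OF RECORD): per family `exists_letters_inEndRegime_leafSlot_of_edges` (`∃ ℓ`, `ℓ.g = g`, THE END's proviso `InEndRegime` and n16-e's `LeafSlot` at RR-1's object
  with letters `ℓ`, N21's numerals, `ℓ.Λ₁ = radiusOfRecord …`); ★ `exists_letters_s_N16_readingOfRecord₁₃On_of_edges` (`∃ ℓ₃`, the K3‴ composer's `h16` at dag-n22-e's named
  reading + the per-family facts), `exists_letters_s_N16_readingOfRecord₁₃_of_edges` (canonical home).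
§3 R-β″ (`S_N16HolderMS β`, `0 ≤ β ≤ 1`; N05's family at exponent `β` with the MS length letter `len (j • e μ) = j`): `exists_letters_inEndRegimeHMS_leafSlotHolderMS_of_edges`,
  ★ `exists_letters_s_N16HolderMS_readingOfRecord₁₃On_of_edges`, `exists_letters_s_N16HolderMS_readingOfRecord₁₃_of_edges` (thresholds `radiusOfRecordHMS` ∕ `constOfRecordHMS`).
(The R-β currency `S_N16Holder β` is the same text over (F2)'s `leafSlotHolder_ofRecord_of_window_linear` ∕ `inEndRegimeH_ofRecord_of_window`; on ask.)

HONEST FRAMING.  Kernel bookkeeping by name + letter arithmetic; no estimate; N05's `Thm4Body` ∕ `Prop3Body` ([Balaban1985RegularSpaces] Thm 4 ∕ Prop 3 as typed by n05-a,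
all-torus sub-family) and N07's linear `LeafH3sup` ([Balaban1985Variational] Thm 1 (8)+(10) TYPE) are HYPOTHESES asserted for no family — this file CHOOSES LETTERS, it proves
neither edge; the localisation letters of the slot witness are DEGENERATE (`Mc := 0`, `C₃₃₅ := 1`, `𝒬 := ∅`, files 17 ∕ 26); `S_N16HolderMS β` is a CANDIDATE stub (R-β″
UNRULED); the reading's `w1` ∕ `ne2` ∕ `ne1` are residual DATA; no admissible Stage-13 tuple with provisos is claimed to exist (K0‴ `Record13Inhabited`, stmt-QuantumFields-19909,
OPEN); nothing of Bałaban's asserted; **N16 ∕ NE3 is NOT discharged**; count-neutral (typed 28∕28 · discharged 5∕27, A 5∕28 UNMOVED); one finite four-torus at fixed ε — NOT ℝ⁴,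
NOT infinite volume, NOT OS, NOT a mass gap, NOT Clay.  No decl below carries a cite tag (all `[folklore]` bookkeeping).
-/

set_option autoImplicit false

open scoped BigOperators Matrix Matrix.Norms.L2Operator
open NormedSpace

namespace Summit.QuantumFields.YangMills.BalabanUVNodes.N16AtRecord13OfEdges

open Literature.MathematicalPhysics.QuantumFieldTheory.Balaban1983to89
open Literature.MathematicalPhysics.QuantumFieldTheory.Balaban1983to89.T4Continuum (T4Family ULoop)
open B7Prop1Explicit B7Prop2Explicit
open B7Prop3Flat (c3)
open B8LeafModelZd (ZdIdx)
open B8LeafModelZd3 (zdGF3)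
open Node00 (IsDatumOfRecord₁₃C Stage13Params NE3Objects₁₁ NE3Letters₁₁ NE2Objects₁₁ ne3ConstLayerOfRecord₁₁ ne3NperOfRecord₁₁ ne3DomOfRecord₁₁ one_le_ne3NperOfRecord₁₁
  MatA)
open Node00.W1 (ReadingData)
open Summit.QuantumFields.BalabanUV.T4Continuum
open BlockAverageCurrent (curConst curConst_nonneg)
open NE3RightInverseSupLetters (frameC)
open NE3.LeafIndexSockets (LeafH3sup)
open YMDAG.UVSplit (Datum NE3Carriers NE1pCarriers S_N16 ne3OfRecord₁₁ RRec₁₃ RRec₁₃On readingOfRecord₁₃)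
open Summit.QuantumFields.YangMills.BalabanUVNodes.N16Regime (InEndRegime radiusOfRecord constOfRecord)
open Summit.QuantumFields.YangMills.BalabanUVNodes.N16LeafSlot (LeafSlot)
open Summit.QuantumFields.YangMills.BalabanUVNodes.N16AtRRec12OfRecord (radiusOfRecord_ofRecord_pos)
open Summit.QuantumFields.YangMills.BalabanUVNodes.N16SlotWindow (inEndRegime_ofRecord_of_window)
open Summit.QuantumFields.YangMills.BalabanUVNodes.N16SlotWindowLinear (leafSlot_ofRecord_of_window_linear)
open Summit.QuantumFields.YangMills.BalabanUVNodes.N16AtReadingOfRecord13 (s_N16_readingOfRecord₁₃On_of_leafSlot s_N16_readingOfRecord₁₃_of_leafSlot)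
open Summit.QuantumFields.YangMills.BalabanUVNodes.N16HolderMSDefs (S_N16HolderMS)
open Summit.QuantumFields.YangMills.BalabanUVNodes.N16HolderMSRegime (InEndRegimeHMS radiusOfRecordHMS constOfRecordHMS radiusOfRecordHMS_pos)
open Summit.QuantumFields.YangMills.BalabanUVNodes.N16HolderMSLeafSlot (LeafSlotHolderMS)
open Summit.QuantumFields.YangMills.BalabanUVNodes.N16HolderMSSlotWindow (leafSlotHolderMS_ofRecord_of_window_linear inEndRegimeHMS_ofRecord_of_window
  s_N16HolderMS_rRec₁₃On_of_constLayer_leafSlotHolderMS s_N16HolderMS_rRec₁₃_of_constLayer_leafSlotHolderMS)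

noncomputable section

variable {N : ℕ} [NeZero N]

/-! ## §1 The letter witness, threshold-parametric, with N07's linear leaf letters inside the slot -/

omit [NeZero N] in
/-- **THE LETTERS OF THE N16 LINES EXIST, WITH ROOM FOR N07's LINEAR LEAF** — for every family `F`, window `c₁' > 0`, N05 inputs `inp`, `B₀β`, coupling letter `g`, radius `r > 0`,
constant `Cof`, and N07's slope `C ≥ 0` with class-radius threshold `ε₀ > 0`: an averaging letter `α` under the five displayed bounds and letters
`ℓ = ⟨ε, b, g, Cof, r, max 1 (177α(B_h+B))⟩` with `ε := min (α∕2) (min ε₀ (α∕(2048(C+1))))`, `b := min (ε∕2) (1∕(512·5·8·L²))` — so `ε < α`, `ε ≤ ε₀`, `C·ε ≤ α∕2048`,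
`ε ≤ r`, N21's numerals, and the window line on `Λ₂'` (file 13's `exists_window_letters_numerals`, class radius shrunk). [folklore] -/
theorem exists_window_letters_linearLeaf (F : T4Family) {c₁' : ℝ} (hc₁' : 0 < c₁') (inp : B8.B9Inputs) (B₀β g : ℝ) {r : ℝ} (hr : 0 < r) (Cof : ℝ)
    {C ε₀ : ℝ} (hC : 0 ≤ C) (hε₀ : 0 < ε₀) :
    ∃ (α : ℝ) (ℓ : NE3Letters₁₁),
      0 < α ∧ α ≤ c₁' / 177 ∧ α ≤ ℓ.Λ₁ / (1770 * (5 * ((4 : ℕ) : ℝ) * F.L * inp.B₀) + 1) ∧ α ≤ c2' 4 F.L / 2 ∧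
      α ≤ 1 / ((23040 * (4 : ℝ) ^ 4 * (frameC 4 F.L + 4) ^ 3 + 12) * (1 + curConst 4 F.L) + 1) ∧ α ≤ 1 / 10 ^ 9 ∧
      ℓ.g = g ∧ 0 < ℓ.ε ∧ ℓ.ε < α ∧ ℓ.ε ≤ ε₀ ∧ C * ℓ.ε ≤ α / 2048 ∧ ℓ.ε ≤ r ∧ ℓ.Λ₁ = r ∧ 0 < ℓ.b ∧ ℓ.b ≤ ℓ.ε / 2 ∧ ℓ.C = Cof ∧
      177 * α * (5 * ((4 : ℕ) : ℝ) * F.L * B₀β + 5 * ((4 : ℕ) : ℝ) * F.L * inp.B₀) ≤ ℓ.Λ₂' ∧ 0 < ℓ.Λ₂' ∧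
      512 * (4 + 1) * (4 + 4) * (F.L : ℝ) ^ 2 * ℓ.b ≤ 1 := by
  have hL : 2 ≤ F.L := HistoryFlow.two_le_L F
  have hL0 : (0 : ℝ) < F.L := by exact_mod_cast lt_of_lt_of_le one_pos (le_trans one_le_two hL)
  have hB₀ := inp.B₀_pos
  obtain ⟨B, hB_def, hB0⟩ : ∃ B : ℝ, B = 5 * ((4 : ℕ) : ℝ) * F.L * inp.B₀ ∧ 0 < B := ⟨_, rfl, by positivity⟩
  obtain ⟨M, hM_def, hM0⟩ : ∃ M : ℝ, M = 23040 * (4 : ℝ) ^ 4 * (frameC 4 F.L + 4) ^ 3 ∧ 0 ≤ M :=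
    ⟨_, rfl, by have : 0 ≤ frameC 4 F.L := by unfold frameC; positivity
                positivity⟩
  have hcur : 0 ≤ curConst 4 F.L := curConst_nonneg (d := 4) F.L
  have hc2 : 0 < c2' 4 F.L := c2'_pos 4 F.L (le_trans one_le_two hL)
  -- the averaging letter
  obtain ⟨α, hα, hα1, hα2, hα3, hα4, hα5⟩ : ∃ α : ℝ, 0 < α ∧ α ≤ c₁' / 177 ∧ α ≤ r / (1770 * B + 1) ∧ α ≤ c2' 4 F.L / 2 ∧
      α ≤ 1 / ((M + 12) * (1 + curConst 4 F.L) + 1) ∧ α ≤ 1 / 10 ^ 9 := by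
    refine ⟨min (min (c₁' / 177) (r / (1770 * B + 1))) (min (c2' 4 F.L / 2) (min (1 / ((M + 12) * (1 + curConst 4 F.L) + 1)) (1 / 10 ^ 9))),
      lt_min (lt_min (by positivity) (by positivity)) (lt_min (by positivity) (lt_min (by positivity) (by norm_num))), ?_, ?_, ?_, ?_, ?_⟩
    · exact (min_le_left _ _).trans (min_le_left _ _)
    · exact (min_le_left _ _).trans (min_le_right _ _)
    · exact (min_le_right _ _).trans (min_le_left _ _)
    · exact (min_le_right _ _).trans ((min_le_right _ _).trans (min_le_left _ _))
    · exact (min_le_right _ _).trans ((min_le_right _ _).trans (min_le_right _ _))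
  have hαr : α ≤ r := hα2.trans (div_le_self hr.le (by linarith only [hB0]))
  -- the class radius: below `α∕2`, below N07's threshold `ε₀`, and so small that `C·ε ≤ α∕2048`
  have hC1 : 0 < 2048 * (C + 1) := by positivity
  obtain ⟨ε, hε_def, hε0, hεα2, hεε₀, hεC⟩ : ∃ ε : ℝ, ε = min (α / 2) (min ε₀ (α / (2048 * (C + 1)))) ∧ 0 < ε ∧ ε ≤ α / 2 ∧ ε ≤ ε₀ ∧
      ε ≤ α / (2048 * (C + 1)) :=
    ⟨_, rfl, lt_min (by positivity) (lt_min hε₀ (by positivity)), min_le_left _ _, (min_le_right _ _).trans (min_le_left _ _),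
      (min_le_right _ _).trans (min_le_right _ _)⟩
  have hCε : C * ε ≤ α / 2048 := by
    have h1 : C * ε ≤ C * (α / (2048 * (C + 1))) := mul_le_mul_of_nonneg_left hεC hC
    have h2 : C * (α / (2048 * (C + 1))) ≤ α / 2048 := by
      rw [mul_div_assoc', div_le_div_iff₀ hC1 (by norm_num : (0 : ℝ) < 2048)]
      nlinarith only [hα, hC, mul_nonneg hC hα.le]
    exact h1.trans h2
  -- the regularity letter inside THE END's tolerance and N21's numeral
  have hK : 0 < 512 * (4 + 1) * (4 + 4) * (F.L : ℝ) ^ 2 := by positivity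
  obtain ⟨b, hb_def, hb0, hb1, hb2⟩ : ∃ b : ℝ, b = min (ε / 2) (1 / (512 * (4 + 1) * (4 + 4) * (F.L : ℝ) ^ 2)) ∧ 0 < b ∧ b ≤ ε / 2 ∧
      b ≤ 1 / (512 * (4 + 1) * (4 + 4) * (F.L : ℝ) ^ 2) :=
    ⟨_, rfl, lt_min (by positivity) (by positivity), min_le_left _ _, min_le_right _ _⟩
  refine ⟨α, ⟨ε, b, g, Cof, r, max 1 (177 * α * (5 * ((4 : ℕ) : ℝ) * F.L * B₀β + 5 * ((4 : ℕ) : ℝ) * F.L * inp.B₀))⟩,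
    hα, hα1, ?_, hα3, ?_, hα5, rfl, hε0, by change ε < α; linarith only [hεα2, hα], hεε₀, hCε, by change ε ≤ r; linarith only [hεα2, hαr, hα], rfl,
    hb0, hb1, rfl, le_max_right _ _, lt_max_of_lt_left one_pos, ?_⟩
  · change α ≤ r / (1770 * (5 * ((4 : ℕ) : ℝ) * F.L * inp.B₀) + 1)
    rw [← hB_def]; exact hα2
  · rw [← hM_def]; exact hα4
  · calc 512 * (4 + 1) * (4 + 4) * (F.L : ℝ) ^ 2 * b
        ≤ 512 * (4 + 1) * (4 + 4) * (F.L : ℝ) ^ 2 * (1 / (512 * (4 + 1) * (4 + 4) * (F.L : ℝ) ^ 2)) := mul_le_mul_of_nonneg_left hb2 hK.le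
      _ = 1 := by field_simp

/-! ## §2 β = 1, THE STUB OF RECORD: letters chosen from N05's leaf and N07's linear leaf, per family; the composer's `h16` at the named reading -/

section Record

variable (Rg : (F : T4Family) → Stage13Params F N → Prop)
  (w1 : (F : T4Family) → (θ : Stage13Params F N) → ReadingData F (MatA N) θ.τ9.M)
  (ne2 : (F : T4Family) → Stage13Params F N → (ℕ → ℝ) → List (ULoop F) → ℕ → NE2Objects₁₁)
  (ne1 : (F : T4Family) → Stage13Params F N → (ℕ → ℝ) → List (ULoop F) → NE1pCarriers)

/-- **PER FAMILY: LETTERS WITH THE END's PROVISO, n16-e's `LeafSlot`, AND N21's NUMERALS, FROM THE TWO IN-EDGES** (β = 1) — N05's Thm-4 ∕ Prop-3 bodies on the univ sub-family of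
`zdGF3 (M_N ℂ) F.L 1 len` with their constants and window (unpacked leaf of record), N07's linear leaf `LeafH3sup … ε (C·ε) (C·ε)` for `0 < ε ≤ ε₀` at RR-1's period and data of
record, and a coupling letter `g > 0` give letters `ℓ` (`ℓ.g = g`, `ℓ.Λ₁ =` THE END's radius of record, `ℓ.C =` its constant) at which `InEndRegime ∧ LeafSlot` holds at RR-1's object
(§1 ∘ file 13's `inEndRegime_ofRecord_of_window` ∘ file 17's `leafSlot_ofRecord_of_window_linear` with `b' = c' = C·ℓ.ε`) together with N21's numerals. [folklore] -/
theorem exists_letters_inEndRegime_leafSlot_of_edges (F : T4Family) {g : ℝ} (hg : 0 < g)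
    (h5 : letI : CStarAlgebra (Matrix (Fin N) (Fin N) ℂ) := {}
      ∃ (len : Site 4 → ℝ) (c₁ c₁' B₁' cP C₂ B₀β : ℝ) (inp : B8.B9Inputs),
        (∀ v : Site 4, 0 < len v → 1 ≤ len v) ∧ (∀ μ : Fin 4, len (e μ) = 1) ∧ 0 < B₁' ∧ 5 * ((4 : ℕ) : ℝ) * F.L * inp.B₀ ≤ B₁' ∧ 0 < c₁' ∧
        (∀ α₀ α₁ : ℝ, 0 < α₀ → 0 < α₁ → α₀ + α₁ ≤ c₁' →
          α₀ + α₁ ≤ c₁ ∧ C0 4 * (2 * α₀) ≤ 1 / 3 ∧ 4 * α₀ ≤ c2' 4 F.L ∧ 16 * (B₁' * (α₀ + α₁)) ≤ 1 ∧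
          Real.exp (4 * (800 * (((4 : ℕ) : ℝ) + 1) ^ 2 * (((4 : ℕ) : ℝ) + 4)) * α₀) * (1 + 8 * (131072 * (((4 : ℕ) : ℝ) + 1) ^ 2) * (B₁' * (α₀ + α₁))) ≤ 2 ∧
          2 * (B₁' * (α₀ + α₁)) ≤ c3 4 F.L ∧ ((4 : ℕ) : ℝ) * F.L * α₁ ≤ 1 / 8 ∧ α₀ ≤ cP ∧ α₁ ≤ cP ∧ B₁' * (α₀ + α₁) ≤ cP ∧
          2 * (B₁' * (α₀ + α₁)) ^ 2 + 20 * ((4 : ℕ) : ℝ) * α₀ * (B₁' * (α₀ + α₁)) + 2 * C₂ * (B₁' * (α₀ + α₁)) ^ 2 ≤ α₀ + α₁) ∧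
        B8.Thm4Body c₁ B₁' (fun i : {i : ZdIdx 4 F.L // i.Ω 0 = Set.univ} => (zdGF3 (Matrix (Fin N) (Fin N) ℂ) F.L 1 len i.1).toGFData) ∧
        B8.Prop3Body cP 4 (F.L : ℝ) C₂ inp B₀β (fun i : {i : ZdIdx 4 F.L // i.Ω 0 = Set.univ} => (zdGF3 (Matrix (Fin N) (Fin N) ℂ) F.L 1 len i.1).toGFData2))
    (h7 : ∃ C ε₀ : ℝ, 0 ≤ C ∧ 0 < ε₀ ∧ ∀ ε : ℝ, 0 < ε → ε ≤ ε₀ →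
      LeafH3sup 4 F.L (ne3NperOfRecord₁₁ F 0 0) ε (C * ε) (C * ε) (ne3DomOfRecord₁₁ F N 0 0)) :
    ∃ ℓ : NE3Letters₁₁, ℓ.g = g ∧ ℓ.Λ₁ = radiusOfRecord N F.L (ne3NperOfRecord₁₁ F 0 0) ∧ ℓ.C = constOfRecord N F.L (ne3NperOfRecord₁₁ F 0 0) g ∧
      0 < ℓ.b ∧ 512 * (4 + 1) * (4 + 4) * (F.L : ℝ) ^ 2 * ℓ.b ≤ 1 ∧ 0 < ℓ.Λ₂' ∧
      InEndRegime (ne3OfRecord₁₁ F (ne3ConstLayerOfRecord₁₁ F N ℓ)) ∧ LeafSlot (ne3OfRecord₁₁ F (ne3ConstLayerOfRecord₁₁ F N ℓ)) := by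
  letI : CStarAlgebra (Matrix (Fin N) (Fin N) ℂ) := {}
  obtain ⟨len, c₁, c₁', B₁', cP, C₂, B₀β, inp, hlen, hlen1, hB₁', hBB, hc₁', hwin, hT, hP⟩ := h5
  obtain ⟨C, ε₀, hC, hε₀, h3⟩ := h7
  obtain ⟨α, ℓ, hα, hα1, hα2, hα3, hα4, hα5, hgℓ, hε0, hε, hεε₀, hCε, hεr, hΛ₁, hb0, hb, hCℓ, hΛ₂', hΛ₂'0, hnum⟩ :=
    exists_window_letters_linearLeaf F hc₁' inp B₀β g (radiusOfRecord_ofRecord_pos (N := N) F) (constOfRecord N F.L (ne3NperOfRecord₁₁ F 0 0) g) hC hε₀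
  have hB0 : 0 < 5 * ((4 : ℕ) : ℝ) * F.L * inp.B₀ := by have := inp.B₀_pos; have := HistoryFlow.two_le_L F; positivity
  have hΛpos : 0 < ℓ.Λ₁ := by rw [hΛ₁]; exact radiusOfRecord_ofRecord_pos (N := N) F
  have hgpos : 0 < ℓ.g := by rw [hgℓ]; exact hg
  refine ⟨ℓ, hgℓ, hΛ₁, hCℓ, hb0, hnum, hΛ₂'0,
    inEndRegime_ofRecord_of_window F (ne3ConstLayerOfRecord₁₁ F N ℓ) (one_le_ne3NperOfRecord₁₁ F 0 0) hgpos hB0.le hα2 hε0 hε hΛ₁.le hb0.le hb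
      (show constOfRecord N F.L (ne3NperOfRecord₁₁ F 0 0) ℓ.g ≤ ℓ.C by rw [hCℓ, hgℓ]), ?_⟩
  have hCε0 : 0 ≤ C * ℓ.ε := mul_nonneg hC hε0.le
  exact leafSlot_ofRecord_of_window_linear F (ne3ConstLayerOfRecord₁₁ F N ℓ) hlen hlen1 hB₁' hBB hc₁' hwin hα hα1 hα2 hα3 hα4 hα5 hε hΛpos hΛ₂' hCε0 hCε hCε0
    (hCε.trans (by linarith only [hα.le] : α / 2048 ≤ α / 24)) hT hP (h3 ℓ.ε hε0 hεε₀)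

/-- ★ **N16 AT THE REGIME-RESTRICTED READING OF RECORD FROM ITS TWO IN-EDGES, LETTERS CHOSEN** (β = 1): N05's unpacked leaf and N07's linear leaf at EVERY family (both are about
`F.L`-indexed objects and read no Stage-13 tuple), and a coupling letter `g F > 0`, give letters of record `ℓ₃` with the K3‴ composer's
`h16 : S_N16 (RRec₁₃On (readingOfRecord₁₃ w1 ℓ₃ ne2 ne1) Rg)` (module 23's `s_N16_readingOfRecord₁₃On_of_leafSlot`) AND, at every family, THE END's proviso, `LeafSlot`, and
dag-n21-d's numerals at `ℓ₃ F` — no letter line is left to the composer; `Rg`, `w1`, `ne2`, `ne1` free. [folklore] -/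
theorem exists_letters_s_N16_readingOfRecord₁₃On_of_edges {g : T4Family → ℝ} (hg : ∀ F, 0 < g F)
    (h5 : ∀ F : T4Family, letI : CStarAlgebra (Matrix (Fin N) (Fin N) ℂ) := {}
      ∃ (len : Site 4 → ℝ) (c₁ c₁' B₁' cP C₂ B₀β : ℝ) (inp : B8.B9Inputs),
        (∀ v : Site 4, 0 < len v → 1 ≤ len v) ∧ (∀ μ : Fin 4, len (e μ) = 1) ∧ 0 < B₁' ∧ 5 * ((4 : ℕ) : ℝ) * F.L * inp.B₀ ≤ B₁' ∧ 0 < c₁' ∧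
        (∀ α₀ α₁ : ℝ, 0 < α₀ → 0 < α₁ → α₀ + α₁ ≤ c₁' →
          α₀ + α₁ ≤ c₁ ∧ C0 4 * (2 * α₀) ≤ 1 / 3 ∧ 4 * α₀ ≤ c2' 4 F.L ∧ 16 * (B₁' * (α₀ + α₁)) ≤ 1 ∧
          Real.exp (4 * (800 * (((4 : ℕ) : ℝ) + 1) ^ 2 * (((4 : ℕ) : ℝ) + 4)) * α₀) * (1 + 8 * (131072 * (((4 : ℕ) : ℝ) + 1) ^ 2) * (B₁' * (α₀ + α₁))) ≤ 2 ∧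
          2 * (B₁' * (α₀ + α₁)) ≤ c3 4 F.L ∧ ((4 : ℕ) : ℝ) * F.L * α₁ ≤ 1 / 8 ∧ α₀ ≤ cP ∧ α₁ ≤ cP ∧ B₁' * (α₀ + α₁) ≤ cP ∧
          2 * (B₁' * (α₀ + α₁)) ^ 2 + 20 * ((4 : ℕ) : ℝ) * α₀ * (B₁' * (α₀ + α₁)) + 2 * C₂ * (B₁' * (α₀ + α₁)) ^ 2 ≤ α₀ + α₁) ∧
        B8.Thm4Body c₁ B₁' (fun i : {i : ZdIdx 4 F.L // i.Ω 0 = Set.univ} => (zdGF3 (Matrix (Fin N) (Fin N) ℂ) F.L 1 len i.1).toGFData) ∧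
        B8.Prop3Body cP 4 (F.L : ℝ) C₂ inp B₀β (fun i : {i : ZdIdx 4 F.L // i.Ω 0 = Set.univ} => (zdGF3 (Matrix (Fin N) (Fin N) ℂ) F.L 1 len i.1).toGFData2))
    (h7 : ∀ F : T4Family, ∃ C ε₀ : ℝ, 0 ≤ C ∧ 0 < ε₀ ∧ ∀ ε : ℝ, 0 < ε → ε ≤ ε₀ →
      LeafH3sup 4 F.L (ne3NperOfRecord₁₁ F 0 0) ε (C * ε) (C * ε) (ne3DomOfRecord₁₁ F N 0 0)) :
    ∃ ℓ₃ : T4Family → NE3Letters₁₁,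
      S_N16 (RRec₁₃On (readingOfRecord₁₃ w1 ℓ₃ ne2 ne1) Rg) ∧
      ∀ F : T4Family, (ℓ₃ F).g = g F ∧ (ℓ₃ F).Λ₁ = radiusOfRecord N F.L (ne3NperOfRecord₁₁ F 0 0) ∧ (ℓ₃ F).C = constOfRecord N F.L (ne3NperOfRecord₁₁ F 0 0) (g F) ∧
        0 < (ℓ₃ F).b ∧ 512 * (4 + 1) * (4 + 4) * (F.L : ℝ) ^ 2 * (ℓ₃ F).b ≤ 1 ∧ 0 < (ℓ₃ F).Λ₂' ∧
        InEndRegime (ne3OfRecord₁₁ F (ne3ConstLayerOfRecord₁₁ F N (ℓ₃ F))) ∧ LeafSlot (ne3OfRecord₁₁ F (ne3ConstLayerOfRecord₁₁ F N (ℓ₃ F))) := by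
  choose ℓ₃ hℓ₃ using fun F => exists_letters_inEndRegime_leafSlot_of_edges (N := N) F (hg F) (h5 F) (h7 F)
  exact ⟨ℓ₃, s_N16_readingOfRecord₁₃On_of_leafSlot Rg w1 ℓ₃ ne2 ne1 (fun F _ => (hℓ₃ F).2.2.2.2.2.2), hℓ₃⟩

/-- **THE SAME AT THE CANONICAL READING OF RECORD** (`S_N16 (RRec₁₃ (readingOfRecord₁₃ w1 ℓ₃ ne2 ne1))`, module 23's `s_N16_readingOfRecord₁₃_of_leafSlot`). [folklore] -/
theorem exists_letters_s_N16_readingOfRecord₁₃_of_edges {g : T4Family → ℝ} (hg : ∀ F, 0 < g F)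
    (h5 : ∀ F : T4Family, letI : CStarAlgebra (Matrix (Fin N) (Fin N) ℂ) := {}
      ∃ (len : Site 4 → ℝ) (c₁ c₁' B₁' cP C₂ B₀β : ℝ) (inp : B8.B9Inputs),
        (∀ v : Site 4, 0 < len v → 1 ≤ len v) ∧ (∀ μ : Fin 4, len (e μ) = 1) ∧ 0 < B₁' ∧ 5 * ((4 : ℕ) : ℝ) * F.L * inp.B₀ ≤ B₁' ∧ 0 < c₁' ∧
        (∀ α₀ α₁ : ℝ, 0 < α₀ → 0 < α₁ → α₀ + α₁ ≤ c₁' →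
          α₀ + α₁ ≤ c₁ ∧ C0 4 * (2 * α₀) ≤ 1 / 3 ∧ 4 * α₀ ≤ c2' 4 F.L ∧ 16 * (B₁' * (α₀ + α₁)) ≤ 1 ∧
          Real.exp (4 * (800 * (((4 : ℕ) : ℝ) + 1) ^ 2 * (((4 : ℕ) : ℝ) + 4)) * α₀) * (1 + 8 * (131072 * (((4 : ℕ) : ℝ) + 1) ^ 2) * (B₁' * (α₀ + α₁))) ≤ 2 ∧
          2 * (B₁' * (α₀ + α₁)) ≤ c3 4 F.L ∧ ((4 : ℕ) : ℝ) * F.L * α₁ ≤ 1 / 8 ∧ α₀ ≤ cP ∧ α₁ ≤ cP ∧ B₁' * (α₀ + α₁) ≤ cP ∧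
          2 * (B₁' * (α₀ + α₁)) ^ 2 + 20 * ((4 : ℕ) : ℝ) * α₀ * (B₁' * (α₀ + α₁)) + 2 * C₂ * (B₁' * (α₀ + α₁)) ^ 2 ≤ α₀ + α₁) ∧
        B8.Thm4Body c₁ B₁' (fun i : {i : ZdIdx 4 F.L // i.Ω 0 = Set.univ} => (zdGF3 (Matrix (Fin N) (Fin N) ℂ) F.L 1 len i.1).toGFData) ∧
        B8.Prop3Body cP 4 (F.L : ℝ) C₂ inp B₀β (fun i : {i : ZdIdx 4 F.L // i.Ω 0 = Set.univ} => (zdGF3 (Matrix (Fin N) (Fin N) ℂ) F.L 1 len i.1).toGFData2))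
    (h7 : ∀ F : T4Family, ∃ C ε₀ : ℝ, 0 ≤ C ∧ 0 < ε₀ ∧ ∀ ε : ℝ, 0 < ε → ε ≤ ε₀ →
      LeafH3sup 4 F.L (ne3NperOfRecord₁₁ F 0 0) ε (C * ε) (C * ε) (ne3DomOfRecord₁₁ F N 0 0)) :
    ∃ ℓ₃ : T4Family → NE3Letters₁₁,
      S_N16 (RRec₁₃ (readingOfRecord₁₃ w1 ℓ₃ ne2 ne1)) ∧
      ∀ F : T4Family, (ℓ₃ F).g = g F ∧ (ℓ₃ F).Λ₁ = radiusOfRecord N F.L (ne3NperOfRecord₁₁ F 0 0) ∧ (ℓ₃ F).C = constOfRecord N F.L (ne3NperOfRecord₁₁ F 0 0) (g F) ∧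
        0 < (ℓ₃ F).b ∧ 512 * (4 + 1) * (4 + 4) * (F.L : ℝ) ^ 2 * (ℓ₃ F).b ≤ 1 ∧ 0 < (ℓ₃ F).Λ₂' ∧
        InEndRegime (ne3OfRecord₁₁ F (ne3ConstLayerOfRecord₁₁ F N (ℓ₃ F))) ∧ LeafSlot (ne3OfRecord₁₁ F (ne3ConstLayerOfRecord₁₁ F N (ℓ₃ F))) := by
  choose ℓ₃ hℓ₃ using fun F => exists_letters_inEndRegime_leafSlot_of_edges (N := N) F (hg F) (h5 F) (h7 F)
  exact ⟨ℓ₃, s_N16_readingOfRecord₁₃_of_leafSlot w1 ℓ₃ ne2 ne1 (fun F _ => (hℓ₃ F).2.2.2.2.2.2), hℓ₃⟩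

end Record

/-! ## §3 Repair R-β″ (`S_N16HolderMS β`, `0 ≤ β ≤ 1`): N05's family at exponent `β` with the MS length letter; MS thresholds -/

section MS

variable {β : ℝ} (hβ0 : 0 ≤ β) (hβ1 : β ≤ 1) (Rg : (F : T4Family) → Stage13Params F N → Prop)
  (w1 : (F : T4Family) → (θ : Stage13Params F N) → ReadingData F (MatA N) θ.τ9.M)
  (ne2 : (F : T4Family) → Stage13Params F N → (ℕ → ℝ) → List (ULoop F) → ℕ → NE2Objects₁₁)
  (ne1 : (F : T4Family) → Stage13Params F N → (ℕ → ℝ) → List (ULoop F) → NE1pCarriers)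

/-- **PER FAMILY, R-β″: LETTERS WITH THE MS PROVISO, THE MS SLOT, AND N21's NUMERALS, FROM THE TWO IN-EDGES** — as §2 with N05's family at exponent `β`, the MS length letter
`len (j • e μ) = j`, and module 24's thresholds `radiusOfRecordHMS` ∕ `constOfRecordHMS` (module 26's `inEndRegimeHMS_ofRecord_of_window`, `leafSlotHolderMS_ofRecord_of_window_linear`).
[folklore] -/
theorem exists_letters_inEndRegimeHMS_leafSlotHolderMS_of_edges (F : T4Family) {g : ℝ} (hg : 0 < g)
    (h5 : letI : CStarAlgebra (Matrix (Fin N) (Fin N) ℂ) := {}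
      ∃ (len : Site 4 → ℝ) (c₁ c₁' B₁' cP C₂ B₀β : ℝ) (inp : B8.B9Inputs),
        (∀ v : Site 4, 0 < len v → 1 ≤ len v) ∧ (∀ (μ : Fin 4) (j : ℕ), len (j • e μ) = j) ∧ 0 < B₁' ∧ 5 * ((4 : ℕ) : ℝ) * F.L * inp.B₀ ≤ B₁' ∧ 0 < c₁' ∧
        (∀ α₀ α₁ : ℝ, 0 < α₀ → 0 < α₁ → α₀ + α₁ ≤ c₁' →
          α₀ + α₁ ≤ c₁ ∧ C0 4 * (2 * α₀) ≤ 1 / 3 ∧ 4 * α₀ ≤ c2' 4 F.L ∧ 16 * (B₁' * (α₀ + α₁)) ≤ 1 ∧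
          Real.exp (4 * (800 * (((4 : ℕ) : ℝ) + 1) ^ 2 * (((4 : ℕ) : ℝ) + 4)) * α₀) * (1 + 8 * (131072 * (((4 : ℕ) : ℝ) + 1) ^ 2) * (B₁' * (α₀ + α₁))) ≤ 2 ∧
          2 * (B₁' * (α₀ + α₁)) ≤ c3 4 F.L ∧ ((4 : ℕ) : ℝ) * F.L * α₁ ≤ 1 / 8 ∧ α₀ ≤ cP ∧ α₁ ≤ cP ∧ B₁' * (α₀ + α₁) ≤ cP ∧
          2 * (B₁' * (α₀ + α₁)) ^ 2 + 20 * ((4 : ℕ) : ℝ) * α₀ * (B₁' * (α₀ + α₁)) + 2 * C₂ * (B₁' * (α₀ + α₁)) ^ 2 ≤ α₀ + α₁) ∧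
        B8.Thm4Body c₁ B₁' (fun i : {i : ZdIdx 4 F.L // i.Ω 0 = Set.univ} => (zdGF3 (Matrix (Fin N) (Fin N) ℂ) F.L β len i.1).toGFData) ∧
        B8.Prop3Body cP 4 (F.L : ℝ) C₂ inp B₀β (fun i : {i : ZdIdx 4 F.L // i.Ω 0 = Set.univ} => (zdGF3 (Matrix (Fin N) (Fin N) ℂ) F.L β len i.1).toGFData2))
    (h7 : ∃ C ε₀ : ℝ, 0 ≤ C ∧ 0 < ε₀ ∧ ∀ ε : ℝ, 0 < ε → ε ≤ ε₀ →
      LeafH3sup 4 F.L (ne3NperOfRecord₁₁ F 0 0) ε (C * ε) (C * ε) (ne3DomOfRecord₁₁ F N 0 0)) :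
    ∃ ℓ : NE3Letters₁₁, ℓ.g = g ∧ ℓ.Λ₁ = radiusOfRecordHMS N F.L (ne3NperOfRecord₁₁ F 0 0) ∧ ℓ.C = constOfRecordHMS N F.L (ne3NperOfRecord₁₁ F 0 0) g ∧
      0 < ℓ.b ∧ 512 * (4 + 1) * (4 + 4) * (F.L : ℝ) ^ 2 * ℓ.b ≤ 1 ∧ 0 < ℓ.Λ₂' ∧
      InEndRegimeHMS (ne3OfRecord₁₁ F (ne3ConstLayerOfRecord₁₁ F N ℓ)) ∧ LeafSlotHolderMS (ne3OfRecord₁₁ F (ne3ConstLayerOfRecord₁₁ F N ℓ)) β := by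
  letI : CStarAlgebra (Matrix (Fin N) (Fin N) ℂ) := {}
  obtain ⟨len, c₁, c₁', B₁', cP, C₂, B₀β, inp, hlen, hlenj, hB₁', hBB, hc₁', hwin, hT, hP⟩ := h5
  obtain ⟨C, ε₀, hC, hε₀, h3⟩ := h7
  have hL : 2 ≤ F.L := HistoryFlow.two_le_L F
  obtain ⟨α, ℓ, hα, hα1, hα2, hα3, hα4, hα5, hgℓ, hε0, hε, hεε₀, hCε, hεr, hΛ₁, hb0, hb, hCℓ, hΛ₂', hΛ₂'0, hnum⟩ :=
    exists_window_letters_linearLeaf F hc₁' inp B₀β g (radiusOfRecordHMS_pos (N := N) hL (one_le_ne3NperOfRecord₁₁ F 0 0))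
      (constOfRecordHMS N F.L (ne3NperOfRecord₁₁ F 0 0) g) hC hε₀
  have hB0 : 0 < 5 * ((4 : ℕ) : ℝ) * F.L * inp.B₀ := by have := inp.B₀_pos; positivity
  have hΛpos : 0 < ℓ.Λ₁ := by rw [hΛ₁]; exact radiusOfRecordHMS_pos (N := N) hL (one_le_ne3NperOfRecord₁₁ F 0 0)
  have hgpos : 0 < ℓ.g := by rw [hgℓ]; exact hg
  refine ⟨ℓ, hgℓ, hΛ₁, hCℓ, hb0, hnum, hΛ₂'0,
    inEndRegimeHMS_ofRecord_of_window F (ne3ConstLayerOfRecord₁₁ F N ℓ) (one_le_ne3NperOfRecord₁₁ F 0 0) hgpos hB0.le hα2 hε0 hε hΛ₁.le hb0.le hb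
      (show constOfRecordHMS N F.L (ne3NperOfRecord₁₁ F 0 0) ℓ.g ≤ ℓ.C by rw [hCℓ, hgℓ]), ?_⟩
  have hCε0 : 0 ≤ C * ℓ.ε := mul_nonneg hC hε0.le
  exact leafSlotHolderMS_ofRecord_of_window_linear F (ne3ConstLayerOfRecord₁₁ F N ℓ) hlen hlenj hB₁' hBB hc₁' hwin hα hα1 hα2 hα3 hα4 hα5 hε hΛpos hΛ₂' hCε0 hCε
    hCε0 (hCε.trans (by linarith only [hα.le] : α / 2048 ≤ α / 24)) hT hP (h3 ℓ.ε hε0 hεε₀)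

include hβ0 hβ1

/-- ★ **N16 UNDER R-β″ AT THE REGIME-RESTRICTED READING OF RECORD FROM ITS TWO IN-EDGES, LETTERS CHOSEN** (`0 ≤ β ≤ 1`): N05's unpacked leaf at exponent `β` (MS length letter) and
N07's linear leaf at every family, `g F > 0`, give letters `ℓ₃` with `S_N16HolderMS β (RRec₁₃On (readingOfRecord₁₃ w1 ℓ₃ ne2 ne1) Rg)` AND the per-family MS proviso, MS slot and N21's
numerals (module 26's const-layer closer at `hpin := rfl`). [folklore] -/
theorem exists_letters_s_N16HolderMS_readingOfRecord₁₃On_of_edges {g : T4Family → ℝ} (hg : ∀ F, 0 < g F)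
    (h5 : ∀ F : T4Family, letI : CStarAlgebra (Matrix (Fin N) (Fin N) ℂ) := {}
      ∃ (len : Site 4 → ℝ) (c₁ c₁' B₁' cP C₂ B₀β : ℝ) (inp : B8.B9Inputs),
        (∀ v : Site 4, 0 < len v → 1 ≤ len v) ∧ (∀ (μ : Fin 4) (j : ℕ), len (j • e μ) = j) ∧ 0 < B₁' ∧ 5 * ((4 : ℕ) : ℝ) * F.L * inp.B₀ ≤ B₁' ∧ 0 < c₁' ∧
        (∀ α₀ α₁ : ℝ, 0 < α₀ → 0 < α₁ → α₀ + α₁ ≤ c₁' →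
          α₀ + α₁ ≤ c₁ ∧ C0 4 * (2 * α₀) ≤ 1 / 3 ∧ 4 * α₀ ≤ c2' 4 F.L ∧ 16 * (B₁' * (α₀ + α₁)) ≤ 1 ∧
          Real.exp (4 * (800 * (((4 : ℕ) : ℝ) + 1) ^ 2 * (((4 : ℕ) : ℝ) + 4)) * α₀) * (1 + 8 * (131072 * (((4 : ℕ) : ℝ) + 1) ^ 2) * (B₁' * (α₀ + α₁))) ≤ 2 ∧
          2 * (B₁' * (α₀ + α₁)) ≤ c3 4 F.L ∧ ((4 : ℕ) : ℝ) * F.L * α₁ ≤ 1 / 8 ∧ α₀ ≤ cP ∧ α₁ ≤ cP ∧ B₁' * (α₀ + α₁) ≤ cP ∧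
          2 * (B₁' * (α₀ + α₁)) ^ 2 + 20 * ((4 : ℕ) : ℝ) * α₀ * (B₁' * (α₀ + α₁)) + 2 * C₂ * (B₁' * (α₀ + α₁)) ^ 2 ≤ α₀ + α₁) ∧
        B8.Thm4Body c₁ B₁' (fun i : {i : ZdIdx 4 F.L // i.Ω 0 = Set.univ} => (zdGF3 (Matrix (Fin N) (Fin N) ℂ) F.L β len i.1).toGFData) ∧
        B8.Prop3Body cP 4 (F.L : ℝ) C₂ inp B₀β (fun i : {i : ZdIdx 4 F.L // i.Ω 0 = Set.univ} => (zdGF3 (Matrix (Fin N) (Fin N) ℂ) F.L β len i.1).toGFData2))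
    (h7 : ∀ F : T4Family, ∃ C ε₀ : ℝ, 0 ≤ C ∧ 0 < ε₀ ∧ ∀ ε : ℝ, 0 < ε → ε ≤ ε₀ →
      LeafH3sup 4 F.L (ne3NperOfRecord₁₁ F 0 0) ε (C * ε) (C * ε) (ne3DomOfRecord₁₁ F N 0 0)) :
    ∃ ℓ₃ : T4Family → NE3Letters₁₁,
      S_N16HolderMS β (RRec₁₃On (readingOfRecord₁₃ w1 ℓ₃ ne2 ne1) Rg) ∧
      ∀ F : T4Family, (ℓ₃ F).g = g F ∧ (ℓ₃ F).Λ₁ = radiusOfRecordHMS N F.L (ne3NperOfRecord₁₁ F 0 0) ∧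
        (ℓ₃ F).C = constOfRecordHMS N F.L (ne3NperOfRecord₁₁ F 0 0) (g F) ∧
        0 < (ℓ₃ F).b ∧ 512 * (4 + 1) * (4 + 4) * (F.L : ℝ) ^ 2 * (ℓ₃ F).b ≤ 1 ∧ 0 < (ℓ₃ F).Λ₂' ∧
        InEndRegimeHMS (ne3OfRecord₁₁ F (ne3ConstLayerOfRecord₁₁ F N (ℓ₃ F))) ∧ LeafSlotHolderMS (ne3OfRecord₁₁ F (ne3ConstLayerOfRecord₁₁ F N (ℓ₃ F))) β := by
  choose ℓ₃ hℓ₃ using fun F => exists_letters_inEndRegimeHMS_leafSlotHolderMS_of_edges (N := N) (β := β) F (hg F) (h5 F) (h7 F)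
  exact ⟨ℓ₃, s_N16HolderMS_rRec₁₃On_of_constLayer_leafSlotHolderMS hβ0 hβ1 _ Rg (fun F => ne3ConstLayerOfRecord₁₁ F N (ℓ₃ F)) (fun _ _ _ _ _ _ => rfl)
    (fun F _ => (hℓ₃ F).2.2.2.2.2.2), hℓ₃⟩

/-- **THE SAME AT THE CANONICAL READING OF RECORD** (`S_N16HolderMS β (RRec₁₃ (readingOfRecord₁₃ w1 ℓ₃ ne2 ne1))`). [folklore] -/
theorem exists_letters_s_N16HolderMS_readingOfRecord₁₃_of_edges {g : T4Family → ℝ} (hg : ∀ F, 0 < g F)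
    (h5 : ∀ F : T4Family, letI : CStarAlgebra (Matrix (Fin N) (Fin N) ℂ) := {}
      ∃ (len : Site 4 → ℝ) (c₁ c₁' B₁' cP C₂ B₀β : ℝ) (inp : B8.B9Inputs),
        (∀ v : Site 4, 0 < len v → 1 ≤ len v) ∧ (∀ (μ : Fin 4) (j : ℕ), len (j • e μ) = j) ∧ 0 < B₁' ∧ 5 * ((4 : ℕ) : ℝ) * F.L * inp.B₀ ≤ B₁' ∧ 0 < c₁' ∧
        (∀ α₀ α₁ : ℝ, 0 < α₀ → 0 < α₁ → α₀ + α₁ ≤ c₁' →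
          α₀ + α₁ ≤ c₁ ∧ C0 4 * (2 * α₀) ≤ 1 / 3 ∧ 4 * α₀ ≤ c2' 4 F.L ∧ 16 * (B₁' * (α₀ + α₁)) ≤ 1 ∧
          Real.exp (4 * (800 * (((4 : ℕ) : ℝ) + 1) ^ 2 * (((4 : ℕ) : ℝ) + 4)) * α₀) * (1 + 8 * (131072 * (((4 : ℕ) : ℝ) + 1) ^ 2) * (B₁' * (α₀ + α₁))) ≤ 2 ∧
          2 * (B₁' * (α₀ + α₁)) ≤ c3 4 F.L ∧ ((4 : ℕ) : ℝ) * F.L * α₁ ≤ 1 / 8 ∧ α₀ ≤ cP ∧ α₁ ≤ cP ∧ B₁' * (α₀ + α₁) ≤ cP ∧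
          2 * (B₁' * (α₀ + α₁)) ^ 2 + 20 * ((4 : ℕ) : ℝ) * α₀ * (B₁' * (α₀ + α₁)) + 2 * C₂ * (B₁' * (α₀ + α₁)) ^ 2 ≤ α₀ + α₁) ∧
        B8.Thm4Body c₁ B₁' (fun i : {i : ZdIdx 4 F.L // i.Ω 0 = Set.univ} => (zdGF3 (Matrix (Fin N) (Fin N) ℂ) F.L β len i.1).toGFData) ∧
        B8.Prop3Body cP 4 (F.L : ℝ) C₂ inp B₀β (fun i : {i : ZdIdx 4 F.L // i.Ω 0 = Set.univ} => (zdGF3 (Matrix (Fin N) (Fin N) ℂ) F.L β len i.1).toGFData2))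
    (h7 : ∀ F : T4Family, ∃ C ε₀ : ℝ, 0 ≤ C ∧ 0 < ε₀ ∧ ∀ ε : ℝ, 0 < ε → ε ≤ ε₀ →
      LeafH3sup 4 F.L (ne3NperOfRecord₁₁ F 0 0) ε (C * ε) (C * ε) (ne3DomOfRecord₁₁ F N 0 0)) :
    ∃ ℓ₃ : T4Family → NE3Letters₁₁,
      S_N16HolderMS β (RRec₁₃ (readingOfRecord₁₃ w1 ℓ₃ ne2 ne1)) ∧
      ∀ F : T4Family, (ℓ₃ F).g = g F ∧ (ℓ₃ F).Λ₁ = radiusOfRecordHMS N F.L (ne3NperOfRecord₁₁ F 0 0) ∧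
        (ℓ₃ F).C = constOfRecordHMS N F.L (ne3NperOfRecord₁₁ F 0 0) (g F) ∧
        0 < (ℓ₃ F).b ∧ 512 * (4 + 1) * (4 + 4) * (F.L : ℝ) ^ 2 * (ℓ₃ F).b ≤ 1 ∧ 0 < (ℓ₃ F).Λ₂' ∧
        InEndRegimeHMS (ne3OfRecord₁₁ F (ne3ConstLayerOfRecord₁₁ F N (ℓ₃ F))) ∧ LeafSlotHolderMS (ne3OfRecord₁₁ F (ne3ConstLayerOfRecord₁₁ F N (ℓ₃ F))) β := by
  choose ℓ₃ hℓ₃ using fun F => exists_letters_inEndRegimeHMS_leafSlotHolderMS_of_edges (N := N) (β := β) F (hg F) (h5 F) (h7 F)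
  exact ⟨ℓ₃, s_N16HolderMS_rRec₁₃_of_constLayer_leafSlotHolderMS hβ0 hβ1 _ (fun F => ne3ConstLayerOfRecord₁₁ F N (ℓ₃ F)) (fun _ _ _ _ _ _ => rfl)
    (fun F _ => (hℓ₃ F).2.2.2.2.2.2), hℓ₃⟩

end MS

end

end Summit.QuantumFields.YangMills.BalabanUVNodes.N16AtRecord13OfEdges
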